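import Literature.NumberTheory.LFunctions.Zhang2022.Section8DipoleProfile
import Literature.NumberTheory.LFunctions.Zhang2022.Section8XiDipoleProfile
import HarnessLib

/-!
# Zhang (2022) §7 Prop 7.1 / §8: the EXACT form of `S_j(𝐚_u, conj 𝐚_u)` for PROFILE data — the double sum over
# `(d,r)` re-indexed by `n = dr`, each term the weight `w_j(d,r)` times the two inner sums `M_j(dr)·N_j(d,r)`

Topic `Literature/NumberTheory/LFunctions/Zhang2022` (Landau–Siegel audit tree; verdict-neutral). Y. Zhang, *Discrete mean
estimates and the Landau–Siegel zero*, arXiv:2211.02515v1 (2022) [Zhang2022LandauSiegel] — **an unrefereed manuscript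
under adjudication; nothing here asserts or denies its Theorems 1–2; no claim about Landau–Siegel zeros.** Cell
landau-siegel §D, crux K0 = stmt-Parity-20459 (row (S) `KnifeEdge.SjProfileRow`, p537807), prover ls-knife-K0-p1 g2.

This is the profile-data twin of `Section8FrontEnd44Exact.Sj_a11_a21_eq` (Zhang's own data `𝐚₁₁, 𝐚₂₁`): for the
coefficient table `𝐚_u = KnifeEdge.profTable u` of a SHORT piece (`u = 0` on `[θ,∞)`) and a real character `χ`,
`S_j(𝐚_u, conj 𝐚_u) = Σ_{1≤n<K} Σ_{dr=n} w_j(d,r)·M_j(n)·N_j(d,r)` — an IDENTITY — where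
`M_j(t) = Σ_m 𝐚_u(tm)m^{β_j−1}` (`psiSum`, the sum evaluated by `DipoleRule.psiRow_C2`),
`N_j(d,r) = Σ_n conj(𝐚_u(drn))ξ₀ⱼ(n;d,r)/n` (`antiSum`, evaluated by `DipoleRule.antiRow_C2`),
`w_j(d,r) = |μ(r)||χ(dr)|λ₀ⱼ(dr)/(drφ(r))` (`sjWeight`, the weight of `Section8FrontEnd44Weights` /
`Section8FrontEnd44ReductionRel.range_sum_le_rel` verbatim), and `K` is any cut with `e^{θ log P} ≤ K ≤ ⌈PT⁻²⌉`
(`M_j(t) = 0` for `t ≥ P^θ`: `psiSum_eq_zero_of_le`). The factor `|χ(dr)|` is free: `M_j(t) = |χ(t)|·M_j(t)`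
(`psiSum_eq_norm_mul`). This is the starting line of the (8.10)–(8.11) GATHERING for profile data.

## References
* Y. Zhang, arXiv:2211.02515v1 (2022), §7 Prop 7.1 (`S_j`), p. 13; §8 display before (8.10), p. 47.
  [cite: Zhang2022LandauSiegel, §7 Prop 7.1; §8 p.47]
-/

noncomputable section

open Complex Real Finset MeasureTheory Set
open scoped ComplexConjugate

namespace Literature.NumberTheory.LFunctions.Zhang2022.DipoleRule

open Skeleton KnifeEdge

/-! ### The three objects -/

/-- **The ψ-side inner sum `M_j(t) = Σ_{1≤m<⌈PT⁻²⌉} 𝐚_u(tm)·m^{β_j−1}`** of Prop 7.1's `S_j` at the profile table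
(outer index `t = dr`). [cite: Zhang2022LandauSiegel, §7 Prop 7.1] -/
def psiSum (c' : ℝ) (D : ℕ) (χ : DirichletCharacter ℂ D) (j : ℕ) (u : ℝ → ℂ) (t : ℕ) : ℂ :=
  ∑ m ∈ Finset.Ico 1 (Nsupp D), profTable u D χ (t * m) / (m : ℂ) ^ (1 - betaJ c' D j)

/-- **The anti-side inner sum `N_j(d,r) = Σ_{1≤n<⌈PT⁻²⌉} conj(𝐚_u(drn))·ξ₀ⱼ(n;d,r)/n`** of Prop 7.1's `S_j` at the
profile table. [cite: Zhang2022LandauSiegel, §7 Prop 7.1] -/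
def antiSum (c' : ℝ) (D : ℕ) (χ : DirichletCharacter ℂ D) (j : ℕ) (u : ℝ → ℂ) (d r : ℕ) : ℂ :=
  ∑ n ∈ Finset.Ico 1 (Nsupp D), conj (profTable u D χ (d * r * n)) * xiZero c' D j n d r / (n : ℂ)

/-- **The weight `w_j(d,r) = |μ(r)|·|χ(dr)|·λ₀ⱼ(dr)/(dr·φ(r))`** of the gathering display (the factor `|χ(dr)|` is
inserted for free, `psiSum_eq_norm_mul`; this is the weight of `Section8FrontEnd44ReductionRel.range_sum_le_rel`).
[cite: Zhang2022LandauSiegel, §8 display before (8.10) p.47] -/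
def sjWeight (c' : ℝ) {D : ℕ} (χ : DirichletCharacter ℂ D) (j : ℕ) (p : ℕ × ℕ) : ℂ :=
  ((ArithmeticFunction.moebius p.2).natAbs : ℂ) * (‖χ ((p.1 * p.2 : ℕ) : ZMod D)‖ : ℂ) /
      (((p.1 * p.2 : ℕ) : ℂ) * (Nat.totient p.2 : ℂ)) * lamZero c' D j (p.1 * p.2)

/-! ### Values of a quadratic character -/

/-- For a quadratic character, `|χ(a)|·χ(a) = χ(a)` (values `0, ±1`; the real primitive `χ (mod D)` of the manuscript).
[cite: Zhang2022LandauSiegel, §2 p.4] -/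
theorem norm_mul_self_of_isQuadratic {D : ℕ} {χ : DirichletCharacter ℂ D} (hq : χ.IsQuadratic) (a : ZMod D) :
    (‖χ a‖ : ℂ) * χ a = χ a := by
  rcases hq a with h | h | h <;> simp [h]

/-- For a quadratic character, `|χ(a)|·χ(a)² = |χ(a)|`. [cite: Zhang2022LandauSiegel, §2 p.4] -/
theorem norm_mul_sq_of_isQuadratic {D : ℕ} {χ : DirichletCharacter ℂ D} (hq : χ.IsQuadratic) (a : ZMod D) :
    (‖χ a‖ : ℂ) * χ a ^ 2 = (‖χ a‖ : ℂ) := by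
  rcases hq a with h | h | h <;> simp [h]

/-- For a quadratic character, `χ(a)² = |χ(a)|`. [cite: Zhang2022LandauSiegel, §2 p.4] -/
theorem sq_eq_norm_of_isQuadratic {D : ℕ} {χ : DirichletCharacter ℂ D} (hq : χ.IsQuadratic) (a : ZMod D) :
    χ a ^ 2 = (‖χ a‖ : ℂ) := by
  rcases hq a with h | h | h <;> simp [h]

/-! ### The `ψ`-side sum: support and the free factor `|χ(t)|` -/

/-- `log P = 𝓛⁹`. [cite: Zhang2022LandauSiegel, §2 (2.6)] -/
private theorem log_bigP' (D : ℕ) : Real.log (bigP D) = Real.log D ^ 9 := by rw [bigP, Real.log_exp]; rfl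

/-- **`M_j(t) = 0` for `t ≥ e^{θ·𝓛⁹} = P^θ`** (every `tm ≥ t` has `z_{tm} ≥ θ`, where `u = 0`).
[cite: Zhang2022LandauSiegel, §7 Prop 7.1 (7.2)] -/
theorem psiSum_eq_zero_of_le {c' : ℝ} {D : ℕ} (χ : DirichletCharacter ℂ D) (j : ℕ) {u : ℝ → ℂ} {θ : ℝ}
    (hvan : ∀ y : ℝ, θ ≤ y → u y = 0) (hℓ : 0 < Real.log D) {t : ℕ}
    (ht : Real.exp (θ * Real.log D ^ 9) ≤ t) : psiSum c' D χ j u t = 0 := by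
  unfold psiSum
  refine Finset.sum_eq_zero fun m hm => ?_
  rw [Finset.mem_Ico] at hm
  have hΛ : 0 < Real.log D ^ 9 := by positivity
  have ht0 : (0 : ℝ) < t := lt_of_lt_of_le (Real.exp_pos _) ht
  have htm : Real.exp (θ * Real.log D ^ 9) ≤ ((t * m : ℕ) : ℝ) := by
    have h1 : (t : ℝ) ≤ ((t * m : ℕ) : ℝ) := by exact_mod_cast Nat.le_mul_of_pos_right t hm.1
    exact ht.trans h1
  have hz : θ ≤ Real.log ((t * m : ℕ) : ℝ) / Real.log (bigP D) := by
    rw [log_bigP', le_div_iff₀ hΛ, ← Real.log_exp (θ * Real.log D ^ 9)]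
    exact Real.log_le_log (Real.exp_pos _) htm
  unfold profTable
  split_ifs with hg
  · rw [hvan _ hz, mul_zero, zero_div]
  · rw [zero_div]

/-- `𝐚_u(tm) = |χ(t)|·𝐚_u(tm)` for a quadratic `χ` (`χ(tm) = χ(t)χ(m)` and `|χ(t)|χ(t) = χ(t)`).
[cite: Zhang2022LandauSiegel, §7 Prop 7.1 (7.2)] -/
theorem profTable_mul_eq_norm_mul {D : ℕ} {χ : DirichletCharacter ℂ D} (hq : χ.IsQuadratic) (u : ℝ → ℂ)
    (t m : ℕ) : profTable u D χ (t * m) = (‖χ (t : ZMod D)‖ : ℂ) * profTable u D χ (t * m) := by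
  unfold profTable
  split_ifs with hg
  · have h := norm_mul_self_of_isQuadratic hq (t : ZMod D)
    have hc : χ ((t * m : ℕ) : ZMod D) = (‖χ (t : ZMod D)‖ : ℂ) * χ ((t * m : ℕ) : ZMod D) := by
      rw [Nat.cast_mul, map_mul, ← mul_assoc, h]
    rw [← mul_assoc, ← hc]
  · rw [mul_zero]

/-- **`M_j(t) = |χ(t)|·M_j(t)`** for a quadratic `χ`. [cite: Zhang2022LandauSiegel, §7 Prop 7.1] -/
theorem psiSum_eq_norm_mul {c' : ℝ} {D : ℕ} {χ : DirichletCharacter ℂ D} (hq : χ.IsQuadratic) (j : ℕ)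
    (u : ℝ → ℂ) (t : ℕ) : psiSum c' D χ j u t = (‖χ (t : ZMod D)‖ : ℂ) * psiSum c' D χ j u t := by
  unfold psiSum
  rw [Finset.mul_sum]
  refine Finset.sum_congr rfl fun m _ => ?_
  rw [mul_div_assoc', ← profTable_mul_eq_norm_mul hq u t m]

/-! ### Re-indexing the double sum over `(d, r)` by `n = dr` -/

/-- The pairs `(d,r)` with `1 ≤ d, r < N` and `dr < K ≤ N` are the factorisations of the `n`, `1 ≤ n < K`. [folklore] -/
private theorem filter_product_eq_biUnion' {N K : ℕ} (hKN : K ≤ N) :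
    (Finset.Ico 1 N ×ˢ Finset.Ico 1 N).filter (fun p : ℕ × ℕ => p.1 * p.2 < K) =
      (Finset.Ico 1 K).biUnion Nat.divisorsAntidiagonal := by
  ext p
  simp only [Finset.mem_filter, Finset.mem_product, Finset.mem_Ico, Finset.mem_biUnion,
    Nat.mem_divisorsAntidiagonal]
  constructor
  · rintro ⟨⟨⟨h1, -⟩, ⟨h2, -⟩⟩, hK⟩
    refine ⟨p.1 * p.2, ⟨Nat.one_le_iff_ne_zero.mpr (Nat.mul_ne_zero (by omega) (by omega)), hK⟩,
      rfl, Nat.mul_ne_zero (by omega) (by omega)⟩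
  · rintro ⟨n, ⟨hn1, hnK⟩, hpn, hn0⟩
    have hp1 : p.1 ≠ 0 := fun h => hn0 (by rw [← hpn, h, zero_mul])
    have hp2 : p.2 ≠ 0 := fun h => hn0 (by rw [← hpn, h, mul_zero])
    have h1 : p.1 ≤ n := by rw [← hpn]; exact Nat.le_mul_of_pos_right _ (Nat.pos_of_ne_zero hp2)
    have h2 : p.2 ≤ n := by rw [← hpn]; exact Nat.le_mul_of_pos_left _ (Nat.pos_of_ne_zero hp1)
    refine ⟨⟨⟨Nat.one_le_iff_ne_zero.mpr hp1, by omega⟩, ⟨Nat.one_le_iff_ne_zero.mpr hp2, by omega⟩⟩,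
      by rw [hpn]; exact hnK⟩

/-- Distinct `n` have disjoint divisor antidiagonals. [folklore] -/
private theorem pairwiseDisjoint_divisorsAntidiagonal' (s : Finset ℕ) :
    (s : Set ℕ).PairwiseDisjoint Nat.divisorsAntidiagonal := by
  intro a _ b _ hab
  rw [Function.onFun, Finset.disjoint_left]
  intro p ha hb
  rw [Nat.mem_divisorsAntidiagonal] at ha hb
  exact hab (ha.1.symm.trans hb.1)

/-- Re-indexing: a double sum over `1 ≤ d, r < N` whose terms vanish for `dr ≥ K` (`K ≤ N`) is the sum over
`1 ≤ n < K` of the sums over the factorisations `n = dr` (the manuscript's «substituting `n = dr`»).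
[cite: Zhang2022LandauSiegel, §8 p.48] -/
theorem sum_sum_eq_sum_antidiagonal_of_vanish {N K : ℕ} (hKN : K ≤ N) (f : ℕ → ℕ → ℂ)
    (hf : ∀ d r : ℕ, 1 ≤ d → 1 ≤ r → K ≤ d * r → f d r = 0) :
    (∑ d ∈ Finset.Ico 1 N, ∑ r ∈ Finset.Ico 1 N, f d r) =
      ∑ n ∈ Finset.Ico 1 K, ∑ p ∈ Nat.divisorsAntidiagonal n, f p.1 p.2 := by
  rw [← Finset.sum_product', ← Finset.sum_biUnion (pairwiseDisjoint_divisorsAntidiagonal' _),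
    ← filter_product_eq_biUnion' hKN, Finset.sum_filter]
  apply Finset.sum_congr rfl
  intro p hp
  rw [Finset.mem_product, Finset.mem_Ico, Finset.mem_Ico] at hp
  by_cases h : p.1 * p.2 < K
  · rw [if_pos h]
  · rw [if_neg h, hf p.1 p.2 hp.1.1 hp.2.1 (not_lt.mp h)]

/-! ### The exact identity -/

/-- The `(d,r)`-term of `S_j` at profile data is `w_j(d,r)·(M_j(dr)·N_j(d,r))` (quadratic `χ`; the factor `|χ(dr)|`
of `w_j` is absorbed by `M_j(dr) = |χ(dr)|M_j(dr)`). [cite: Zhang2022LandauSiegel, §7 Prop 7.1; §8 p.47] -/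
theorem sj_term_eq {c' : ℝ} {D : ℕ} {χ : DirichletCharacter ℂ D} (hq : χ.IsQuadratic) (j : ℕ) (u : ℝ → ℂ)
    (d r : ℕ) :
    ((ArithmeticFunction.moebius r).natAbs : ℂ) * lamZero c' D j (d * r) / ((d * r : ℕ) * (Nat.totient r : ℂ)) *
        (∑ m ∈ Finset.Ico 1 (Nsupp D), profTable u D χ (d * r * m) / (m : ℂ) ^ (1 - betaJ c' D j)) *
        (∑ n ∈ Finset.Ico 1 (Nsupp D),
          (fun k => conj (profTable u D χ k)) (d * r * n) * xiZero c' D j n d r / (n : ℂ))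
      = sjWeight c' χ j (d, r) * (psiSum c' D χ j u (d * r) * antiSum c' D χ j u d r) := by
  have hM : (∑ m ∈ Finset.Ico 1 (Nsupp D), profTable u D χ (d * r * m) / (m : ℂ) ^ (1 - betaJ c' D j))
      = psiSum c' D χ j u (d * r) := rfl
  have hN : (∑ n ∈ Finset.Ico 1 (Nsupp D),
      (fun k => conj (profTable u D χ k)) (d * r * n) * xiZero c' D j n d r / (n : ℂ)) = antiSum c' D χ j u d r := rfl
  rw [hM, hN]
  nth_rewrite 1 [psiSum_eq_norm_mul hq j u (d * r)]
  unfold sjWeight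
  simp only [Nat.cast_mul]
  ring

/-- **THE EXACT FORM OF `S_j(𝐚_u, conj 𝐚_u)` FOR A SHORT PIECE:** for a quadratic `χ`, `u = 0` on `[θ,∞)`, `𝓛 > 0`,
and any cut `K` with `e^{θ𝓛⁹} ≤ K ≤ ⌈PT⁻²⌉`:
`S_j(𝐚_u, conj 𝐚_u) = Σ_{1≤n<K} Σ_{(d,r): dr=n} w_j(d,r)·(M_j(n)·N_j(d,r))` — an identity, no error term.
[cite: Zhang2022LandauSiegel, §7 Prop 7.1; §8 display before (8.10) p.47] -/
theorem Sj_profTable_eq (c' : ℝ) {D : ℕ} {χ : DirichletCharacter ℂ D} (hq : χ.IsQuadratic) (j : ℕ)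
    {u : ℝ → ℂ} {θ : ℝ} (hvan : ∀ y : ℝ, θ ≤ y → u y = 0) (hℓ : 0 < Real.log D) {K : ℕ}
    (hK : Real.exp (θ * Real.log D ^ 9) ≤ K) (hKN : K ≤ Nsupp D) :
    Sj c' D j (profTable u D χ) (fun n => conj (profTable u D χ n))
      = ∑ n ∈ Finset.Ico 1 K, ∑ p ∈ Nat.divisorsAntidiagonal n,
          sjWeight c' χ j p * (psiSum c' D χ j u n * antiSum c' D χ j u p.1 p.2) := by
  unfold Sj
  rw [Finset.sum_congr rfl fun d _ => Finset.sum_congr rfl fun r _ => sj_term_eq hq j u d r]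
  rw [sum_sum_eq_sum_antidiagonal_of_vanish hKN
    (fun d r => sjWeight c' χ j (d, r) * (psiSum c' D χ j u (d * r) * antiSum c' D χ j u d r))]
  · refine Finset.sum_congr rfl fun n _ => Finset.sum_congr rfl fun p hp => ?_
    rw [Nat.mem_divisorsAntidiagonal] at hp
    rw [← hp.1]
  · intro d r _ _ hdr
    have ht : Real.exp (θ * Real.log D ^ 9) ≤ ((d * r : ℕ) : ℝ) := hK.trans (by exact_mod_cast hdr)
    rw [psiSum_eq_zero_of_le χ j hvan hℓ ht, zero_mul, mul_zero]

/-- The same identity with the `n`-range split at an intermediate cut `Y` (`1 ≤ Y ≤ K`): the «good» range `n < Y`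
(where Lemmas 8.2/8.4 evaluate both inner sums) and the SLIVER `Y ≤ n < K`.
[cite: Zhang2022LandauSiegel, §8 display before (8.10) p.47] -/
theorem Sj_profTable_eq_split (c' : ℝ) {D : ℕ} {χ : DirichletCharacter ℂ D} (hq : χ.IsQuadratic) (j : ℕ)
    {u : ℝ → ℂ} {θ : ℝ} (hvan : ∀ y : ℝ, θ ≤ y → u y = 0) (hℓ : 0 < Real.log D) {Y K : ℕ} (hY : 1 ≤ Y)
    (hYK : Y ≤ K) (hK : Real.exp (θ * Real.log D ^ 9) ≤ K) (hKN : K ≤ Nsupp D) :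
    Sj c' D j (profTable u D χ) (fun n => conj (profTable u D χ n))
      = (∑ n ∈ Finset.Ico 1 Y, ∑ p ∈ Nat.divisorsAntidiagonal n,
          sjWeight c' χ j p * (psiSum c' D χ j u n * antiSum c' D χ j u p.1 p.2))
        + ∑ n ∈ Finset.Ico Y K, ∑ p ∈ Nat.divisorsAntidiagonal n,
          sjWeight c' χ j p * (psiSum c' D χ j u n * antiSum c' D χ j u p.1 p.2) := by
  rw [Sj_profTable_eq c' hq j hvan hℓ hK hKN, Finset.sum_Ico_consecutive _ hY hYK]

/-- **The norm of the weight** is the real weight of `Section8FrontEnd44Weights`: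
`‖w_j(d,r)‖ = |μ(r)|·‖λ₀ⱼ(n)‖·|χ(n)|/(n·φ(r)) ≤ |μ(r)|‖λ₀ⱼ(n)‖/(nφ(r))`, `n = dr ≥ 1`.
[cite: Zhang2022LandauSiegel, §8 display before (8.10) p.47] -/
theorem norm_sjWeight_le (c' : ℝ) {D : ℕ} (χ : DirichletCharacter ℂ D) (j : ℕ) {n : ℕ}
    {p : ℕ × ℕ} (hp : p ∈ Nat.divisorsAntidiagonal n) :
    ‖sjWeight c' χ j p‖ ≤ ((ArithmeticFunction.moebius p.2).natAbs : ℝ) * ‖lamZero c' D j n‖ /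
      ((n : ℝ) * Nat.totient p.2) := by
  rw [Nat.mem_divisorsAntidiagonal] at hp
  obtain ⟨hpn, hn0⟩ := hp
  have hp2 : p.2 ≠ 0 := fun h => hn0 (by rw [← hpn, h, mul_zero])
  have hφ : (0 : ℝ) < Nat.totient p.2 := by exact_mod_cast Nat.totient_pos.mpr (Nat.pos_of_ne_zero hp2)
  have hnR : (0 : ℝ) < n := by exact_mod_cast Nat.pos_of_ne_zero hn0
  unfold sjWeight
  rw [hpn, norm_mul, norm_div, norm_mul, norm_mul, Complex.norm_natCast, Complex.norm_real, norm_norm,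
    Complex.norm_natCast, Complex.norm_natCast]
  have hχ : ‖χ (n : ZMod D)‖ ≤ 1 := χ.norm_le_one _
  calc ((ArithmeticFunction.moebius p.2).natAbs : ℝ) * ‖χ (n : ZMod D)‖ / ((n : ℝ) * Nat.totient p.2) *
        ‖lamZero c' D j n‖
      ≤ ((ArithmeticFunction.moebius p.2).natAbs : ℝ) * 1 / ((n : ℝ) * Nat.totient p.2) * ‖lamZero c' D j n‖ := by
        gcongr
    _ = _ := by ring

end Literature.NumberTheory.LFunctions.Zhang2022.DipoleRule

end
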